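import Summits.CriticalPhenomena.PercolationContinuityZ3.Theorems.PercNearOneGluingNoHeavyLowerTailSunflowerLeafLeafZTwo
import HarnessLib

/-!
# `NoHeavyLowerTail` (crux stmt-CriticalPhenomena-4575), abstract sunflower cubic: THE LEAF-LEAF LEMMA FOR DIAGONAL FAMILIES —
# every petal system of `A ∪ [z₁u] ∪ [z₂w] ∪ [z₁z₂]` whose petals do not depend on ONE of the two leaves satisfies Lemma A

Support file (seat `prim-ineq-prove-1` gen 66; `--supports stmt-CriticalPhenomena-4575`).  No `sorry`, no named facts, no new
definitions.  Memo: run/shared/lean/prim/prim-ineq-prove-1/FINDING-RLA-prove1-g66.md §4.6.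

SETTING (`…SunflowerLeafLeaf`, `…SunflowerLeafLeafZTwo`, `…SunflowerLeafLeafBase`).  `A' = A ∪ {z₁,u open} ∪ ({z₁,z₂ open} ∪ {z₂,w open})`
is the core of `Γ + z₁z₂` for leaves `z₁ ~ u`, `z₂ ~ w`; `C = A ∪ {z₁,u open}` (= `A'` with `z₂` closed; safe by the pendant theorem),
`T = C ∪ {z₁ open} ∪ {w open}` (= `A'` with `z₂` open; safe by two one-coin steps, `safe_union_open`).  A petal `W ⊇ A'` is
`z₂`-DIAGONAL when `W = V ∪ A'` with `V` not depending on `z₂`; then its `z₂`-sections are `L = V ∪ C` and `U = V ∪ T = L ∪ T`.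
* **`leafLeaf_diagonal`** (fixed `p`): if `C` and `delMinor w A` are safe at `p` and `μ(delMinor w A) > 0`, EVERY family of up-sets not
  depending on `z₂` and meeting pairwise inside `A'` satisfies `∏ μ(V_i) ≤ μ(A')^(n−1)`.  (Symmetrically for `z₁`, by relabelling.)  This
  contains the base case (petals ignoring both leaves: `…SunflowerLeafLeafBase`, whose hypothesis `BaseFour` is thereby bypassed), all
  families of `z₁`-side hubs / `[z₁w]`- / `[z₁]`-petals, etc.; what remains of the general leaf-leaf lemma are the families mixing petals with
  `z₂`-side slack (`U ⊋ L ∪ T`) and petals with `z₁`-side slack (memo §4.3).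
  PROOF (memo §4.6).  `μ(W_i) = t·μ(U_i) + (1−t)·μ(L_i)` (`t = p_{z₂}`); `{L_i}` is a petal system of `C` (`∏ μ(L_i) ≤ g^(n−1)`, `g = μ(C)`),
  `{U_i}` one of `T` (`∏ μ(U_i) ≤ a^(n−1)`, `a = μ(T)`), and diagonality gives the ALIGNMENT `g·μ(U_i) ≤ a·μ(L_i)` (from
  `μ(L_i ∪ T) + μ(C) ≤ μ(L_i) + μ(T)` and `g ≤ a`).  For aligned pairs the two-coin factors MERGE
  (`LeafLeafZ.aligned_merge_prod_le`: `(tA₁+(1−t)ψ₁)(tA₂+(1−t)ψ₂) ≤ (ta+(1−t)g)(t·A₁A₂/a + (1−t)·ψ₁ψ₂/g)`, the difference being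
  `t(1−t)(aψ₁−gA₁)(aψ₂−gA₂)/(ag)`), so the whole family merges into one petal whose value the two budgets bound by `1`
  (`LeafLeafZ.interp_prod_le`).
* `leafLeaf_diagonal_aSafe`: the same from A-safety of `A` (+ positivity); `safe_union_open`: `A ∪ {w open}` is safe when `delMinor w A` is.
-/

noncomputable section

namespace Summit.CriticalPhenomena.PercolationContinuityZ3.Theorems.SunflowerPartition

namespace SafeCalc

open MeasureTheory Finset
open Literature.Probability.LatticeModels Literature.Probability.Percolation

/-! ## The analytic core: aligned two-coin factors merge -/

namespace LeafLeafZ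

variable {κ : Type*}

/-- **Aligned merging of two-coin factors.**  `0 < g`, `0 < a`, `t ∈ [0,1]`, petals `(A_i, ψ_i)` with `A_i, ψ_i ≥ 0` and the alignment
`g·A_i ≤ a·ψ_i`.  Then `∏_S (tA_i + (1−t)ψ_i) ≤ (ta + (1−t)g)^(|S|−1)·(t·∏A_i/a^(|S|−1) + (1−t)·∏ψ_i/g^(|S|−1))` (`S` nonempty).
[this work] -/
theorem aligned_merge_prod_le [DecidableEq κ] {t a g : ℝ} (ht0 : 0 ≤ t) (ht1 : t ≤ 1) (ha : 0 < a) (hg : 0 < g) (S : Finset κ)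
    (hS : S.Nonempty) (A ψ : κ → ℝ) (hA : ∀ i ∈ S, 0 ≤ A i) (hψ : ∀ i ∈ S, 0 ≤ ψ i) (hal : ∀ i ∈ S, g * A i ≤ a * ψ i) :
    ∏ i ∈ S, (t * A i + (1 - t) * ψ i) ≤
      (t * a + (1 - t) * g) ^ (S.card - 1) * (t * ((∏ i ∈ S, A i) / a ^ (S.card - 1)) + (1 - t) * ((∏ i ∈ S, ψ i) / g ^ (S.card - 1))) := by
  classical
  induction S using Finset.induction_on with
  | empty => exact absurd hS (by simp)
  | @insert j S hj ih =>
    rcases S.eq_empty_or_nonempty with rfl | hSne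
    · simp
    · have hA' : ∀ i ∈ S, 0 ≤ A i := fun i hi => hA i (mem_insert_of_mem hi)
      have hψ' : ∀ i ∈ S, 0 ≤ ψ i := fun i hi => hψ i (mem_insert_of_mem hi)
      have hal' : ∀ i ∈ S, g * A i ≤ a * ψ i := fun i hi => hal i (mem_insert_of_mem hi)
      have ih' := ih hSne hA' hψ' hal'
      have hAj : 0 ≤ A j := hA j (mem_insert_self j S)
      have hψj : 0 ≤ ψ j := hψ j (mem_insert_self j S)
      have halj : g * A j ≤ a * ψ j := hal j (mem_insert_self j S)
      have ht' : 0 ≤ 1 - t := sub_nonneg.2 ht1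
      have hF : 0 ≤ t * a + (1 - t) * g := add_nonneg (mul_nonneg ht0 ha.le) (mul_nonneg ht' hg.le)
      have hFj : 0 ≤ t * A j + (1 - t) * ψ j := add_nonneg (mul_nonneg ht0 hAj) (mul_nonneg ht' hψj)
      -- the merged petal of `S` is aligned
      set PA : ℝ := (∏ i ∈ S, A i) / a ^ (S.card - 1) with hPA
      set Pψ : ℝ := (∏ i ∈ S, ψ i) / g ^ (S.card - 1) with hPψ
      have hcard : S.card = S.card - 1 + 1 := (Nat.sub_add_cancel (card_pos.2 hSne)).symm
      have hprodal : g ^ S.card * ∏ i ∈ S, A i ≤ a ^ S.card * ∏ i ∈ S, ψ i := by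
        rw [← prod_const, ← prod_const, ← prod_mul_distrib, ← prod_mul_distrib]
        exact prod_le_prod (fun i hi => mul_nonneg hg.le (hA' i hi)) fun i hi => hal' i hi
      have halP : g * PA ≤ a * Pψ := by
        rw [hPA, hPψ, mul_div_assoc', mul_div_assoc', div_le_div_iff₀ (pow_pos ha _) (pow_pos hg _)]
        have e1 : g * (∏ i ∈ S, A i) * g ^ (S.card - 1) = g ^ S.card * ∏ i ∈ S, A i := by
          conv_rhs => rw [hcard, pow_succ]
          ring
        have e2 : a * (∏ i ∈ S, ψ i) * a ^ (S.card - 1) = a ^ S.card * ∏ i ∈ S, ψ i := by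
          conv_rhs => rw [hcard, pow_succ]
          ring
        rw [e1, e2]; exact hprodal
      -- two-petal merge: `(tA_j+(1−t)ψ_j)(tPA+(1−t)Pψ) ≤ (ta+(1−t)g)(t A_j PA/a + (1−t) ψ_j Pψ/g)`
      have hmerge : (t * A j + (1 - t) * ψ j) * (t * PA + (1 - t) * Pψ) ≤
          (t * a + (1 - t) * g) * (t * (A j * PA / a) + (1 - t) * (ψ j * Pψ / g)) := by
        rw [← sub_nonneg]
        have key : (t * a + (1 - t) * g) * (t * (A j * PA / a) + (1 - t) * (ψ j * Pψ / g)) -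
            (t * A j + (1 - t) * ψ j) * (t * PA + (1 - t) * Pψ) = t * (1 - t) * ((a * ψ j - g * A j) * (a * Pψ - g * PA) / (a * g)) := by
          field_simp
          ring
        rw [key]
        exact mul_nonneg (mul_nonneg ht0 ht') (div_nonneg (mul_nonneg (sub_nonneg.2 halj) (sub_nonneg.2 halP)) (mul_pos ha hg).le)
      have hcard2 : (insert j S).card - 1 = S.card := by rw [card_insert_of_notMem hj]; simp
      have hFpow : (t * a + (1 - t) * g) ^ S.card = (t * a + (1 - t) * g) ^ (S.card - 1) * (t * a + (1 - t) * g) := by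
        conv_lhs => rw [hcard, pow_succ]
      have hap : a ^ S.card = a ^ (S.card - 1) * a := by conv_lhs => rw [hcard, pow_succ]
      have hgp : g ^ S.card = g ^ (S.card - 1) * g := by conv_lhs => rw [hcard, pow_succ]
      have eA : A j * PA / a = (A j * ∏ i ∈ S, A i) / a ^ S.card := by
        rw [hPA, hap]; field_simp
      have eψ : ψ j * Pψ / g = (ψ j * ∏ i ∈ S, ψ i) / g ^ S.card := by
        rw [hPψ, hgp]; field_simp
      rw [prod_insert hj, prod_insert hj, prod_insert hj, hcard2]
      calc (t * A j + (1 - t) * ψ j) * ∏ i ∈ S, (t * A i + (1 - t) * ψ i)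
          ≤ (t * A j + (1 - t) * ψ j) * ((t * a + (1 - t) * g) ^ (S.card - 1) * (t * PA + (1 - t) * Pψ)) :=
            mul_le_mul_of_nonneg_left ih' hFj
        _ = (t * a + (1 - t) * g) ^ (S.card - 1) * ((t * A j + (1 - t) * ψ j) * (t * PA + (1 - t) * Pψ)) := by ring
        _ ≤ (t * a + (1 - t) * g) ^ (S.card - 1) * ((t * a + (1 - t) * g) * (t * (A j * PA / a) + (1 - t) * (ψ j * Pψ / g))) :=
            mul_le_mul_of_nonneg_left hmerge (pow_nonneg hF _)
        _ = (t * a + (1 - t) * g) ^ S.card * (t * ((A j * ∏ i ∈ S, A i) / a ^ S.card) + (1 - t) * ((ψ j * ∏ i ∈ S, ψ i) / g ^ S.card)) := by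
            rw [eA, eψ, hFpow]; ring

/-- **Interpolation between two Lemma-A budgets for an aligned family**: with the budgets `∏_S A_i ≤ a^(|S|−1)`, `∏_S ψ_i ≤ g^(|S|−1)`,
`∏_S (tA_i + (1−t)ψ_i) ≤ (ta + (1−t)g)^(|S|−1)`. [this work] -/
theorem interp_prod_le [DecidableEq κ] {t a g : ℝ} (ht0 : 0 ≤ t) (ht1 : t ≤ 1) (ha : 0 < a) (hg : 0 < g) (S : Finset κ)
    (hS : S.Nonempty) (A ψ : κ → ℝ) (hA : ∀ i ∈ S, 0 ≤ A i) (hψ : ∀ i ∈ S, 0 ≤ ψ i) (hal : ∀ i ∈ S, g * A i ≤ a * ψ i)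
    (hBA : ∏ i ∈ S, A i ≤ a ^ (S.card - 1)) (hBψ : ∏ i ∈ S, ψ i ≤ g ^ (S.card - 1)) :
    ∏ i ∈ S, (t * A i + (1 - t) * ψ i) ≤ (t * a + (1 - t) * g) ^ (S.card - 1) := by
  have h := aligned_merge_prod_le ht0 ht1 ha hg S hS A ψ hA hψ hal
  have ht' : 0 ≤ 1 - t := sub_nonneg.2 ht1
  have h1 : (∏ i ∈ S, A i) / a ^ (S.card - 1) ≤ 1 := by rw [div_le_one (pow_pos ha _)]; exact hBA
  have h2 : (∏ i ∈ S, ψ i) / g ^ (S.card - 1) ≤ 1 := by rw [div_le_one (pow_pos hg _)]; exact hBψ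
  have hF : 0 ≤ t * a + (1 - t) * g := add_nonneg (mul_nonneg ht0 ha.le) (mul_nonneg ht' hg.le)
  refine h.trans ?_
  have h3 : t * ((∏ i ∈ S, A i) / a ^ (S.card - 1)) + (1 - t) * ((∏ i ∈ S, ψ i) / g ^ (S.card - 1)) ≤ 1 := by
    nlinarith [mul_le_mul_of_nonneg_left h1 ht0, mul_le_mul_of_nonneg_left h2 ht']
  calc (t * a + (1 - t) * g) ^ (S.card - 1) * (t * ((∏ i ∈ S, A i) / a ^ (S.card - 1)) + (1 - t) * ((∏ i ∈ S, ψ i) / g ^ (S.card - 1)))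
      ≤ (t * a + (1 - t) * g) ^ (S.card - 1) * 1 := mul_le_mul_of_nonneg_left h3 (pow_nonneg hF _)
    _ = _ := mul_one _

end LeafLeafZ

/-! ## Safety of `A ∪ {w open}` -/

open RelLemmaA UnionEdge LeafLeafZ

variable {ι : Type*} [Fintype ι] [DecidableEq ι] (p : ι → unitInterval)

/-- **`A ∪ {w open}` is safe when `delMinor w A` is safe** (and has positive measure): conditioning on `w`, a petal of `A ∪ {w open}`
has `w`-open section everything and `w`-closed sections forming a petal system of `delMinor w A`; the one-coin lemma
`LinkedCurrency.prod_wavg_le` finishes. [this work] -/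
theorem safe_union_open (w : ι) {A : Set (Set ι)} (hA : IsUpperSet A) (hA0 : Safe p (delMinor w A))
    (hpos : 0 < (prodBernoulli p).real (delMinor w A)) : Safe p (A ∪ {ω | w ∈ ω}) := by
  classical
  intro n V hV hcap
  rcases Nat.eq_zero_or_pos n with rfl | hn
  · simp
  set B : Set (Set ι) := A ∪ {ω | w ∈ ω} with hB
  have hwup : IsUpperSet {ω : Set ι | w ∈ ω} := fun _ _ hle h => hle h
  have hBup : IsUpperSet B := hA.union hwup
  set W : Fin n → Set (Set ι) := fun i => V i ∪ B with hW
  have hWup : ∀ i, IsUpperSet (W i) := fun i => (hV i).union hBup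
  have hWcap : ∀ i j, i ≠ j → W i ∩ W j ⊆ B := by
    intro i j hij ω hω
    rcases hω with ⟨h1 | h1, h2 | h2⟩
    · exact hcap i j hij ⟨h1, h2⟩
    exacts [h2, h1, h1]
  have hB_off : secOff w B = secOff w A := by rw [hB, secOff_union, secOff_setOf_mem_self, Set.union_empty]
  set s : ℝ := ((p w : unitInterval) : ℝ) with hs
  have hs0 : 0 ≤ s := (p w).2.1
  have hs1 : s ≤ 1 := (p w).2.2
  set b : ℝ := (prodBernoulli p).real (delMinor w A) with hb
  set x : Fin n → ℝ := fun i => (prodBernoulli p).real (secOff w (W i)) with hx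
  have hxb : ∀ i ∈ (univ : Finset (Fin n)), b ≤ x i := fun i _ =>
    measureReal_mono (show secOff w A ⊆ secOff w (W i) from hB_off ▸ secOff_mono w Set.subset_union_right)
  have hBx : ∏ i ∈ (univ : Finset (Fin n)), x i ≤ b ^ ((univ : Finset (Fin n)).card - 1) := by
    rw [card_univ, Fintype.card_fin]
    exact hA0 n (fun i => secOff w (W i)) (fun i => isUpperSet_secOff w (hWup i))
      (fun i j hij => by rw [← secOff_inter, show delMinor w A = secOff w A from rfl, ← hB_off]; exact secOff_mono w (hWcap i j hij))
  have hval : ∀ i, (prodBernoulli p).real (W i) ≤ (1 - s) * x i + s * 1 := by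
    intro i
    rw [real_eq_secOn_secOff p w (W i)]
    have h1 : (prodBernoulli p).real (secOn w (W i)) ≤ 1 := measureReal_le_one
    nlinarith [mul_le_mul_of_nonneg_left h1 hs0]
  have hBval : (prodBernoulli p).real B = (1 - s) * b + s * 1 := by
    rw [real_eq_secOn_secOff p w B, hB, secOn_union, secOn_setOf_mem_self, Set.union_univ, probReal_univ, ← hB, hB_off,
      show secOff w A = delMinor w A from rfl, ← hb, ← hs]
    ring
  have hne : (univ : Finset (Fin n)).Nonempty := ⟨⟨0, hn⟩, mem_univ _⟩
  have key := LinkedCurrency.prod_wavg_le (s := 1 - s) (e := (1 : ℝ)) (sub_nonneg.2 hs1) (by linarith) zero_le_one hpos univ hne x hxb hBx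
  rw [card_univ, Fintype.card_fin] at key
  have e1 : ((1 - s) * b + (1 - (1 - s)) * (1 : ℝ)) ^ (n - 1) * ((1 - s) + (1 - (1 - s)) * (1 : ℝ)) =
      (prodBernoulli p).real B ^ (n - 1) := by rw [hBval]; ring
  rw [e1] at key
  calc ∏ i, (prodBernoulli p).real (V i) ≤ ∏ i, (prodBernoulli p).real (W i) :=
        prod_le_prod (fun i _ => measureReal_nonneg) fun i _ => measureReal_mono Set.subset_union_left
    _ ≤ ∏ i, ((1 - s) * x i + (1 - (1 - s)) * (1 : ℝ)) :=
        prod_le_prod (fun i _ => measureReal_nonneg) fun i _ => by have := hval i; linarith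
    _ ≤ (prodBernoulli p).real B ^ (n - 1) := key

/-! ## The leaf-leaf lemma for `z₂`-diagonal families -/

/-- **THE LEAF-LEAF LEMMA FOR `z₂`-DIAGONAL FAMILIES (fixed `p`).**  `A` an up-set not depending on `z₁, z₂`; `z₁, z₂, u, w` pairwise
distinct; `C = A ∪ {z₁,u open}` and `delMinor w A` safe at `p`, `μ(delMinor w A) > 0`.  Then every family of up-sets `V_i` NOT
DEPENDING ON `z₂` and meeting pairwise inside `A' = A ∪ {z₁,u open} ∪ ({z₁,z₂ open} ∪ {z₂,w open})` satisfies
`∏ μ(V_i) ≤ μ(A')^(n−1)`. [this work] -/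
theorem leafLeaf_diagonal {z₁ z₂ u w : ι} (h12 : z₁ ≠ z₂) (h1w : z₁ ≠ w) (h2u : z₂ ≠ u) (h2w : z₂ ≠ w)
    {A : Set (Set ι)} (hd₁ : DeterminedBy A (↑({z₁} : Finset ι) : Set ι)ᶜ)
    (hd₂ : DeterminedBy A (↑({z₂} : Finset ι) : Set ι)ᶜ) (hA : IsUpperSet A)
    (hC : Safe p (A ∪ pairOpen z₁ u)) (hAw : Safe p (delMinor w A)) (hpos : 0 < (prodBernoulli p).real (delMinor w A))
    {n : ℕ} (V : Fin n → Set (Set ι)) (hV : ∀ i, IsUpperSet (V i))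
    (hV₂ : ∀ i, DeterminedBy (V i) (↑({z₂} : Finset ι) : Set ι)ᶜ)
    (hcap : ∀ i j, i ≠ j → V i ∩ V j ⊆ A ∪ pairOpen z₁ u ∪ (pairOpen z₁ z₂ ∪ pairOpen z₂ w)) :
    ∏ i, (prodBernoulli p).real (V i) ≤
      (prodBernoulli p).real (A ∪ pairOpen z₁ u ∪ (pairOpen z₁ z₂ ∪ pairOpen z₂ w)) ^ (n - 1) := by
  classical
  rcases Nat.eq_zero_or_pos n with rfl | hn
  · simp
  set A' : Set (Set ι) := A ∪ pairOpen z₁ u ∪ (pairOpen z₁ z₂ ∪ pairOpen z₂ w) with hA'def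
  set C : Set (Set ι) := A ∪ pairOpen z₁ u with hCdef
  set T : Set (Set ι) := A ∪ pairOpen z₁ u ∪ ({ω | z₁ ∈ ω} ∪ {ω | w ∈ ω}) with hTdef
  have hz₁up : IsUpperSet {ω : Set ι | z₁ ∈ ω} := fun _ _ hle h => hle h
  have hwup : IsUpperSet {ω : Set ι | w ∈ ω} := fun _ _ hle h => hle h
  have hCup : IsUpperSet C := hA.union (isUpperSet_pairOpen z₁ u)
  have hTup : IsUpperSet T := hCup.union (hz₁up.union hwup)
  have hA'up : IsUpperSet A' := hCup.union ((isUpperSet_pairOpen z₁ z₂).union (isUpperSet_pairOpen z₂ w))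
  have hCT : C ⊆ T := Set.subset_union_left
  -- sections of `A'` at `z₂`
  have hA'_on : secOn z₂ A' = T := by
    rw [hA'def, secOn_union, secOn_union, secOn_union, secOn_eq_self_of_determinedBy hd₂, secOn_pairOpen_of_ne h12 h2u.symm,
      secOn_pairOpen_right h12, secOn_pairOpen_left h2w]
  have hA'_off : secOff z₂ A' = C := by
    rw [hA'def, secOff_union, secOff_union, secOff_union, secOff_eq_self_of_determinedBy hd₂,
      secOff_pairOpen_of_ne h12 h2u.symm, secOff_pairOpen_right, secOff_pairOpen_left, Set.union_empty, Set.union_empty]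
  -- `T` is safe: `T = (A ∪ {w open}) ∪ {z₁ open}`
  have hTeq : T = (A ∪ {ω | w ∈ ω}) ∪ {ω | z₁ ∈ ω} := by
    ext ω
    simp only [hTdef, pairOpen, Set.mem_union, Set.mem_setOf_eq]
    tauto
  have hA1up : IsUpperSet (A ∪ {ω : Set ι | w ∈ ω}) := hA.union hwup
  have hA1_off : secOff z₁ (A ∪ {ω : Set ι | w ∈ ω}) = A ∪ {ω | w ∈ ω} := by
    rw [secOff_union, secOff_eq_self_of_determinedBy hd₁, secOff_setOf_mem_of_ne h1w.symm]
  have hA1safe : Safe p (A ∪ {ω : Set ι | w ∈ ω}) := safe_union_open p w hA hAw hpos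
  have hA1pos : 0 < (prodBernoulli p).real (delMinor z₁ (A ∪ {ω : Set ι | w ∈ ω})) := by
    rw [show delMinor z₁ (A ∪ {ω : Set ι | w ∈ ω}) = secOff z₁ (A ∪ {ω | w ∈ ω}) from rfl, hA1_off]
    exact hpos.trans_le (measureReal_mono ((delMinor_subset w hA).trans Set.subset_union_left))
  have hTsafe : Safe p T := by
    rw [hTeq]
    refine safe_union_open p z₁ hA1up ?_ hA1pos
    rw [show delMinor z₁ (A ∪ {ω : Set ι | w ∈ ω}) = secOff z₁ (A ∪ {ω | w ∈ ω}) from rfl, hA1_off]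
    exact hA1safe
  -- enlarge the petals; sections
  set W : Fin n → Set (Set ι) := fun i => V i ∪ A' with hW
  have hWup : ∀ i, IsUpperSet (W i) := fun i => (hV i).union hA'up
  have hWcap : ∀ i j, i ≠ j → W i ∩ W j ⊆ A' := by
    intro i j hij ω hω
    rcases hω with ⟨h1 | h1, h2 | h2⟩
    · exact hcap i j hij ⟨h1, h2⟩
    exacts [h2, h1, h1]
  have hmono : ∀ i, (prodBernoulli p).real (V i) ≤ (prodBernoulli p).real (W i) :=
    fun i => measureReal_mono Set.subset_union_left
  set L : Fin n → Set (Set ι) := fun i => secOff z₂ (W i) with hL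
  set U : Fin n → Set (Set ι) := fun i => secOn z₂ (W i) with hU
  have hLeq : ∀ i, L i = V i ∪ C := by
    intro i; simp only [hL, hW]; rw [secOff_union, secOff_eq_self_of_determinedBy (hV₂ i), hA'_off]
  have hUeq : ∀ i, U i = L i ∪ T := by
    intro i; rw [hLeq i]; simp only [hU, hW]
    rw [secOn_union, secOn_eq_self_of_determinedBy (hV₂ i), hA'_on, Set.union_assoc, Set.union_eq_self_of_subset_left hCT]
  have hLup : ∀ i, IsUpperSet (L i) := fun i => isUpperSet_secOff z₂ (hWup i)
  have hUup : ∀ i, IsUpperSet (U i) := fun i => isUpperSet_secOn z₂ (hWup i)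
  have hLC : ∀ i, C ⊆ L i := fun i => (hLeq i) ▸ Set.subset_union_right
  have hLcap : ∀ i j, i ≠ j → L i ∩ L j ⊆ C := fun i j hij => by
    simp only [hL]; rw [← secOff_inter, ← hA'_off]; exact secOff_mono z₂ (hWcap i j hij)
  have hUcap : ∀ i j, i ≠ j → U i ∩ U j ⊆ T := fun i j hij => by
    simp only [hU]; rw [← secOn_inter, ← hA'_on]; exact secOn_mono z₂ (hWcap i j hij)
  -- numbers
  set t : ℝ := ((p z₂ : unitInterval) : ℝ) with ht
  have ht0 : 0 ≤ t := (p z₂).2.1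
  have ht1 : t ≤ 1 := (p z₂).2.2
  set g : ℝ := (prodBernoulli p).real C with hgdef
  set a : ℝ := (prodBernoulli p).real T with hadef
  have hga : g ≤ a := measureReal_mono hCT
  have hgpos : 0 < g := by
    refine hpos.trans_le (measureReal_mono ?_)
    exact (delMinor_subset w hA).trans Set.subset_union_left
  have hapos : 0 < a := hgpos.trans_le hga
  set Av : Fin n → ℝ := fun i => (prodBernoulli p).real (U i) with hAv
  set ψv : Fin n → ℝ := fun i => (prodBernoulli p).real (L i) with hψv
  -- budgets
  have hcardn : (univ : Finset (Fin n)).card = n := by simp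
  have hBψ : ∏ i ∈ (univ : Finset (Fin n)), ψv i ≤ g ^ ((univ : Finset (Fin n)).card - 1) := by
    rw [hcardn]; exact hC n L hLup hLcap
  have hBA : ∏ i ∈ (univ : Finset (Fin n)), Av i ≤ a ^ ((univ : Finset (Fin n)).card - 1) := by
    rw [hcardn]; exact hTsafe n U hUup hUcap
  -- alignment `g·μ(U_i) ≤ a·μ(L_i)` from `μ(L_i ∪ T) + μ(L_i ∩ T) = μ(L_i) + μ(T)` and `C ⊆ L_i ∩ T`
  have hal : ∀ i ∈ (univ : Finset (Fin n)), g * Av i ≤ a * ψv i := by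
    intro i _
    have h1 : (prodBernoulli p).real (L i ∪ T) + (prodBernoulli p).real (L i ∩ T) =
        (prodBernoulli p).real (L i) + (prodBernoulli p).real T :=
      measureReal_union_add_inter MeasurableSet.of_discrete
    have h2 : g ≤ (prodBernoulli p).real (L i ∩ T) := measureReal_mono (Set.subset_inter (hLC i) hCT)
    have h3 : Av i = (prodBernoulli p).real (L i ∪ T) := by simp only [hAv]; rw [hUeq i]
    have h4 : g ≤ ψv i := measureReal_mono (hLC i)
    have h5 : Av i + g ≤ ψv i + a := by rw [h3]; simp only [hψv, hadef]; linarith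
    nlinarith [mul_le_mul_of_nonneg_left h4 (sub_nonneg.2 hga)]
  -- assemble
  have hne : (univ : Finset (Fin n)).Nonempty := ⟨⟨0, hn⟩, mem_univ _⟩
  have key := interp_prod_le ht0 ht1 hapos hgpos univ hne Av ψv (fun i _ => measureReal_nonneg)
    (fun i _ => measureReal_nonneg) hal hBA hBψ
  rw [hcardn] at key
  have hA'val : (prodBernoulli p).real A' = t * a + (1 - t) * g := by
    rw [real_eq_secOn_secOff p z₂ A', hA'_on, hA'_off]
  have hWval : ∀ i, (prodBernoulli p).real (W i) = t * Av i + (1 - t) * ψv i := by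
    intro i; rw [real_eq_secOn_secOff p z₂ (W i)]
  rw [hA'val]
  calc ∏ i, (prodBernoulli p).real (V i) ≤ ∏ i, (prodBernoulli p).real (W i) :=
        prod_le_prod (fun i _ => measureReal_nonneg) fun i _ => hmono i
    _ = ∏ i, (t * Av i + (1 - t) * ψv i) := prod_congr rfl fun i _ => hWval i
    _ ≤ (t * a + (1 - t) * g) ^ (n - 1) := key

/-- **The leaf-leaf lemma for `z₂`-diagonal families from A-safety of `A`** (+ positivity `μ_p(delMinor w A) > 0`): the safety of
`A ∪ {z₁,u open}` is the pendant theorem, that of `delMinor w A` is `aSafe_delMinor`. [this work] -/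
theorem leafLeaf_diagonal_aSafe {z₁ z₂ u w : ι} (h12 : z₁ ≠ z₂) (h1u : z₁ ≠ u) (h1w : z₁ ≠ w) (h2u : z₂ ≠ u) (h2w : z₂ ≠ w)
    {A : Set (Set ι)} (hd₁ : DeterminedBy A (↑({z₁} : Finset ι) : Set ι)ᶜ)
    (hd₂ : DeterminedBy A (↑({z₂} : Finset ι) : Set ι)ᶜ) (hA : IsUpperSet A) (hsafe : ∀ q, Safe q A)
    (hpos : 0 < (prodBernoulli p).real (delMinor w A))
    {n : ℕ} (V : Fin n → Set (Set ι)) (hV : ∀ i, IsUpperSet (V i))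
    (hV₂ : ∀ i, DeterminedBy (V i) (↑({z₂} : Finset ι) : Set ι)ᶜ)
    (hcap : ∀ i j, i ≠ j → V i ∩ V j ⊆ A ∪ pairOpen z₁ u ∪ (pairOpen z₁ z₂ ∪ pairOpen z₂ w)) :
    ∏ i, (prodBernoulli p).real (V i) ≤
      (prodBernoulli p).real (A ∪ pairOpen z₁ u ∪ (pairOpen z₁ z₂ ∪ pairOpen z₂ w)) ^ (n - 1) := by
  have hC : Safe p (A ∪ pairOpen z₁ u) := by
    rw [pairOpen_comm]
    exact Pendant.safe_union_pendant p h1u.symm hd₁ hA (hsafe p) (aSafe_delMinor hA hsafe u p) (aSafe_conMinor hA hsafe u p)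
  exact leafLeaf_diagonal p h12 h1w h2u h2w hd₁ hd₂ hA hC (aSafe_delMinor hA hsafe w p) hpos V hV hV₂ hcap

/-- **Graph form.**  `z₁, z₂` isolated in `Γ₀`, `edgeCore Γ₀` A-safe, `Γ' = Γ₀ + z₁u + z₂w + z₁z₂`; then for every `p` with
`μ_p(delMinor w (edgeCore Γ₀)) > 0`, every family of up-sets not depending on `z₂` and meeting pairwise inside `edgeCore Γ'` satisfies
Lemma A. [this work] -/
theorem leafLeaf_diagonal_graph (Γ₀ : SimpleGraph ι) {z₁ z₂ u w : ι} (h12 : z₁ ≠ z₂) (h1u : z₁ ≠ u) (h1w : z₁ ≠ w)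
    (h2u : z₂ ≠ u) (h2w : z₂ ≠ w) (hz₁ : ∀ x, ¬ Γ₀.Adj z₁ x) (hz₂ : ∀ x, ¬ Γ₀.Adj z₂ x)
    (hsafe : ∀ q : ι → unitInterval, Safe q (edgeCore Γ₀)) (hpos : 0 < (prodBernoulli p).real (delMinor w (edgeCore Γ₀)))
    {n : ℕ} (V : Fin n → Set (Set ι)) (hV : ∀ i, IsUpperSet (V i))
    (hV₂ : ∀ i, DeterminedBy (V i) (↑({z₂} : Finset ι) : Set ι)ᶜ)
    (hcap : ∀ i j, i ≠ j → V i ∩ V j ⊆ edgeCore (Γ₀ ⊔ SimpleGraph.fromEdgeSet {s(z₁, u)} ⊔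
      SimpleGraph.fromEdgeSet {s(z₂, w)} ⊔ SimpleGraph.fromEdgeSet {s(z₁, z₂)})) :
    ∏ i, (prodBernoulli p).real (V i) ≤
      (prodBernoulli p).real (edgeCore (Γ₀ ⊔ SimpleGraph.fromEdgeSet {s(z₁, u)} ⊔ SimpleGraph.fromEdgeSet {s(z₂, w)} ⊔
        SimpleGraph.fromEdgeSet {s(z₁, z₂)})) ^ (n - 1) := by
  classical
  have hcore : edgeCore (Γ₀ ⊔ SimpleGraph.fromEdgeSet {s(z₁, u)} ⊔ SimpleGraph.fromEdgeSet {s(z₂, w)} ⊔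
      SimpleGraph.fromEdgeSet {s(z₁, z₂)}) = edgeCore Γ₀ ∪ pairOpen z₁ u ∪ (pairOpen z₁ z₂ ∪ pairOpen z₂ w) := by
    rw [edgeCore_sup_edge _ h12, edgeCore_sup_edge _ h2w, edgeCore_sup_edge _ h1u, Set.union_assoc _ (pairOpen z₂ w),
      Set.union_comm (pairOpen z₂ w)]
  rw [hcore] at hcap ⊢
  exact leafLeaf_diagonal_aSafe p h12 h1u h1w h2u h2w (determinedBy_edgeCore_of_isolated_one Γ₀ hz₁)
    (determinedBy_edgeCore_of_isolated_one Γ₀ hz₂) (isUpperSet_edgeCore Γ₀) hsafe hpos V hV hV₂ hcap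

end SafeCalc

end Summit.CriticalPhenomena.PercolationContinuityZ3.Theorems.SunflowerPartition
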